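import Mathlib
import Literature.Probability.Moments.PermutedSumBernstein

/-!
# The deficit budget: marginal DEFICITS of a set of permutations are entropy-priced

Helper file for the LEVEL-ONE programme on the crux `SnSubsetDichotomy.PolynomialSlack`
(stmt-MatrixMultiplication-8306; idea card `deficit-budget-positivity`, "DEFICIT BUDGET"). For
`X ⊆ S_n` with marginals `M_X(i,j) = #{x ∈ X : x j = i}` the DEFICITS `δ(i,j) = max(0, |X|/n - M_X(i,j))`
(each at most `|X|/n` deep, unlike bumps) satisfy the one-sided, globalness-free level-one inequality

  `Σ_{i,j} δ(i,j)² ≤ 100 · (|X|²/n) · log(4n·n!/|X|)`          (`deficit_budget`),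

CONDITIONAL on the Bernstein inequality for randomly permuted sums of Bercu–Delyon–Rio (2015), quoted
as Thm. 1.5 of Albert 2019 — the tree's named fact
`Literature.Probability.Moments.BercuDelyonRio2015_permutedSum` (tail form, `PermutedSumBernstein.lean`). Proof: with `η = δ·n/|X| ∈ [0,1]` and `F(π) = Σ_j η(π j, j)`, the KEY IDENTITY
`Σ_{x ∈ X} F(x) = Σ η·M_X = |X|·(m - v)` (`m = Ση/n` the mean of `F` over `S_n`, `v = Ση²/n`): on `X` the
statistic `F` sits `v` below its mean ON AVERAGE; one threshold `t₀ = √(32θvL) + 11L`,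
`L = log(4n·n!/|X|)`, and the tail bound `#{π : |F(π) - m| ≥ t₀} ≤ 4·n!·e^{-t₀²/(16(θv + t₀/3))} ≤ |X|/n`
give `v ≤ t₀ + 1`, whence `v ≤ (32θ + 22)L + 2 ≤ 100L`.

References: B. Bercu, B. Delyon, E. Rio, *Concentration Inequalities for Sums and Martingales*,
SpringerBriefs (2015); M. Albert, *Concentration inequalities for randomly permuted sums*, in: High
Dimensional Probability VIII, Progr. Probab. 74 (2019), Thm. 1.5 (arXiv:1805.03579, p. 4).
-/

namespace Summit.MatrixMultiplication.MatrixMultiplication.Theorems.PolynomialSlack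

open scoped BigOperators

-- `Summit.<Summit>.<Problem>` is the tree's mandated summit-side namespace (CONVENTIONS §2); for
-- this single-conjunct summit the two coincide, so each declaration silences `dupNamespace`.
set_option linter.dupNamespace false

/-- `1 < log 3 ≤ log 2 + 1/2`. [folklore] -/
theorem log_three_bounds : 1 < Real.log 3 ∧ Real.log 3 ≤ 0.6931471808 + 1 / 2 := by
  constructor
  · rw [Real.lt_log_iff_exp_lt (by norm_num)]
    exact lt_trans Real.exp_one_lt_d9 (by norm_num)
  · have h2 : Real.log 2 ≤ 0.6931471808 := Real.log_two_lt_d9.le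
    have h15 : Real.log (3 / 2) ≤ 1 / 2 := by
      rw [Real.log_le_iff_le_exp (by norm_num)]
      have := Real.add_one_le_exp (1 / 2 : ℝ)
      linarith
    have : Real.log 3 = Real.log 2 + Real.log (3 / 2) := by
      rw [← Real.log_mul (by norm_num) (by norm_num)]; norm_num
    linarith

/-- **The key identity.** For `X ⊆ S_n` and any weights `η`, `Σ_{x ∈ X} Σ_j η(x j, j) = Σ_{i,j} η(i,j)·M_X(i,j)`
(group the `x ∈ X` by the value `i = x j`). [folklore] -/
theorem sum_sum_apply_eq_sum_mul_marginal {n : ℕ} (X : Finset (Equiv.Perm (Fin n))) (η : Fin n → Fin n → ℝ) :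
    ∑ x ∈ X, ∑ j : Fin n, η (x j) j =
      ∑ i : Fin n, ∑ j : Fin n, η i j * ((X.filter fun x => x j = i).card : ℝ) := by
  classical
  rw [Finset.sum_comm]
  rw [Finset.sum_comm (s := Finset.univ) (t := Finset.univ)]
  refine Finset.sum_congr rfl fun j _ => ?_
  rw [← Finset.sum_fiberwise_of_maps_to (s := X) (t := Finset.univ) (g := fun x => x j)
    (fun _ _ => Finset.mem_univ _)]
  refine Finset.sum_congr rfl fun i _ => ?_
  rw [Finset.sum_congr rfl fun x hx => by rw [(Finset.mem_filter.1 hx).2], Finset.sum_const,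
    nsmul_eq_mul, mul_comm]

set_option maxHeartbeats 800000 in
/-- **The deficit budget** (conditional on the named fact `BercuDelyonRio2015_permutedSum`): for `X ⊆ S_n` non-empty,
`Σ_{i,j} max(0, |X|/n - M_X(i,j))² ≤ 100·(|X|²/n)·log(4n·n!/|X|)`. [folklore] -/
theorem deficit_budget (hBDR : Literature.Probability.Moments.BercuDelyonRio2015_permutedSum) {n : ℕ} (hn : 1 ≤ n)
    (X : Finset (Equiv.Perm (Fin n))) (hX : X.Nonempty) :
    ∑ i : Fin n, ∑ j : Fin n,
        (max 0 ((X.card : ℝ) / n - ((X.filter fun x => x j = i).card : ℝ))) ^ 2 ≤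
      100 * ((X.card : ℝ) ^ 2 / n) * Real.log (4 * n * n.factorial / X.card) := by
  classical
  -- notation
  set α : ℝ := (X.card : ℝ) with hα
  have hα0 : 0 < α := by rw [hα]; exact_mod_cast hX.card_pos
  have hnR : (1 : ℝ) ≤ n := by exact_mod_cast hn
  have hn0 : (0 : ℝ) < n := by linarith
  set M : Fin n → Fin n → ℝ := fun i j => ((X.filter fun x => x j = i).card : ℝ) with hM
  set δ : Fin n → Fin n → ℝ := fun i j => max 0 (α / n - M i j) with hδ
  set η : Fin n → Fin n → ℝ := fun i j => δ i j * (n / α) with hη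
  have hM0 : ∀ i j, 0 ≤ M i j := fun i j => Nat.cast_nonneg _
  have hδ0 : ∀ i j, 0 ≤ δ i j := fun i j => le_max_left _ _
  have hδle : ∀ i j, δ i j ≤ α / n := fun i j =>
    max_le (div_nonneg hα0.le hn0.le) (by linarith [hM0 i j])
  have hη0 : ∀ i j, 0 ≤ η i j := fun i j => mul_nonneg (hδ0 i j) (by positivity)
  have hη1 : ∀ i j, η i j ≤ 1 := fun i j => by
    calc η i j = δ i j * (n / α) := rfl
      _ ≤ (α / n) * (n / α) := mul_le_mul_of_nonneg_right (hδle i j) (by positivity)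
      _ = 1 := by field_simp
  have hδη : ∀ i j, δ i j = (α / n) * η i j := fun i j => by
    simp only [hη]; field_simp
  -- the deficit cells: `η · M = η · (α/n - δ)`
  have hcell : ∀ i j, η i j * M i j = η i j * (α / n - δ i j) := by
    intro i j
    by_cases h : α / n - M i j ≤ 0
    · have : δ i j = 0 := by simp only [hδ]; exact max_eq_left h
      have hη00 : η i j = 0 := by simp only [hη, this, zero_mul]
      rw [hη00, zero_mul, zero_mul]
    · have : δ i j = α / n - M i j := max_eq_right (by linarith)
      rw [this]; ring
  -- the statistic `F`, its mean `m` and variance proxy `v`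
  set mη : ℝ := (∑ j : Fin n, ∑ i : Fin n, η i j) / n with hmη
  set v : ℝ := (∑ j : Fin n, ∑ i : Fin n, η i j ^ 2) / n with hv
  have hv0 : 0 ≤ v := div_nonneg (Finset.sum_nonneg fun _ _ => Finset.sum_nonneg fun _ _ => sq_nonneg _) hn0.le
  have hmηle : mη ≤ n := by
    rw [hmη, div_le_iff₀ hn0]
    calc ∑ j : Fin n, ∑ i : Fin n, η i j ≤ ∑ j : Fin n, ∑ i : Fin n, (1 : ℝ) :=
          Finset.sum_le_sum fun j _ => Finset.sum_le_sum fun i _ => hη1 i j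
      _ = n * n := by simp
  have hmη0 : 0 ≤ mη := div_nonneg (Finset.sum_nonneg fun _ _ => Finset.sum_nonneg fun _ _ => hη0 _ _) hn0.le
  -- KEY IDENTITY: `Σ_{x ∈ X} F(x) = α (m - v)`
  have hkey : ∑ x ∈ X, ∑ j : Fin n, η (x j) j = α * (mη - v) := by
    rw [sum_sum_apply_eq_sum_mul_marginal X η]
    simp_rw [show ∀ i j, η i j * ((X.filter fun x => x j = i).card : ℝ) = η i j * M i j from
      fun i j => rfl, hcell, hδη]
    rw [hmη, hv, Finset.sum_comm (s := Finset.univ) (t := Finset.univ) (f := fun j i => η i j),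
      Finset.sum_comm (s := Finset.univ) (t := Finset.univ) (f := fun j i => η i j ^ 2)]
    have : ∀ i j, η i j * (α / n - α / n * η i j) = α / n * η i j - α / n * η i j ^ 2 := by
      intro i j; ring
    simp_rw [this, Finset.sum_sub_distrib, ← Finset.mul_sum]
    field_simp
  -- the threshold
  set L : ℝ := Real.log (4 * n * n.factorial / X.card) with hL
  set θ : ℝ := 5 / 2 * Real.log 3 - 2 / 3 with hθ
  obtain ⟨hlog3, hlog3'⟩ := log_three_bounds
  have hθ0 : 0 < θ := by rw [hθ]; linarith
  have hθle : θ ≤ 2.32 := by rw [hθ]; linarith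
  have hαle : α ≤ n.factorial := by
    rw [hα]
    have : X.card ≤ Fintype.card (Equiv.Perm (Fin n)) := Finset.card_le_univ _
    rw [Fintype.card_perm, Fintype.card_fin] at this
    exact_mod_cast this
  have hY : 4 ≤ 4 * n * n.factorial / α := by
    rw [le_div_iff₀ hα0]
    have hf : (1 : ℝ) ≤ n.factorial := by exact_mod_cast n.factorial_pos
    nlinarith
  have hY0 : 0 < 4 * n * n.factorial / α := by linarith
  have hL1 : 1 ≤ L := by
    rw [hL, ← hα, Real.le_log_iff_exp_le hY0]
    exact le_trans Real.exp_one_lt_d9.le (by linarith)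
  have hL0 : 0 < L := by linarith
  set r : ℝ := Real.sqrt (32 * θ * v * L) with hr
  have hr0 : 0 ≤ r := Real.sqrt_nonneg _
  have h32 : 0 ≤ 32 * θ * v * L :=
    mul_nonneg (mul_nonneg (mul_nonneg (by norm_num) hθ0.le) hv0) hL0.le
  have hrsq : r * r = 32 * θ * v * L := Real.mul_self_sqrt h32
  set t₀ : ℝ := r + 11 * L with ht₀
  have ht₀0 : 0 < t₀ := by rw [ht₀]; linarith
  -- the exponent is at least `L`
  have hden0 : 0 < 16 * (θ * v + 1 * t₀ / 3) := by
    have : 0 ≤ θ * v := mul_nonneg hθ0.le hv0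
    linarith
  have hexp : L ≤ t₀ ^ 2 / (16 * (θ * v + 1 * t₀ / 3)) := by
    rw [le_div_iff₀ hden0, ht₀]
    nlinarith [hrsq, hr0, hL0.le, mul_nonneg hr0 hL0.le, mul_nonneg hθ0.le hv0]
  -- BDR applied to `a j i := η i j` (entries in `[0,1]`), threshold `t₀`
  have hBound := hBDR n 1 (fun j i => η i j) (fun j i => by
    rw [abs_le]; exact ⟨by linarith [hη0 i j], hη1 i j⟩) t₀ ht₀0
  -- the tail set is at most `|X| / n`... precisely `4 n! e^{-g} ≤ 4 n! e^{-L} = α / n`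
  have htail : 4 * (n.factorial : ℝ) *
      Real.exp (-(t₀ ^ 2 / (16 * (θ * v + 1 * t₀ / 3)))) ≤ α / n := by
    have h1 : Real.exp (-(t₀ ^ 2 / (16 * (θ * v + 1 * t₀ / 3)))) ≤ Real.exp (-L) :=
      Real.exp_le_exp.2 (neg_le_neg hexp)
    have h2 : Real.exp (-L) = α / (4 * n * n.factorial) := by
      rw [Real.exp_neg, hL, ← hα, Real.exp_log hY0, inv_div]
    have hf0 : (0 : ℝ) < n.factorial := by exact_mod_cast n.factorial_pos
    calc 4 * (n.factorial : ℝ) * Real.exp (-(t₀ ^ 2 / (16 * (θ * v + 1 * t₀ / 3))))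
        ≤ 4 * (n.factorial : ℝ) * Real.exp (-L) := by gcongr
      _ = α / n := by rw [h2]; field_simp
  -- split `X` at the threshold
  set B := X.filter fun x => t₀ ≤ mη - ∑ j : Fin n, η (x j) j with hB
  have hBsub : B.card ≤ (Finset.univ.filter fun π : Equiv.Perm (Fin n) =>
      t₀ ≤ |∑ j : Fin n, η (π j) j - (∑ j : Fin n, ∑ i : Fin n, η i j) / n|).card := by
    refine Finset.card_le_card fun x hx => ?_
    rw [Finset.mem_filter] at hx ⊢
    refine ⟨Finset.mem_univ _, ?_⟩
    rw [← hmη, abs_sub_comm]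
    exact hx.2.trans (le_abs_self _)
  have hBcard : (B.card : ℝ) ≤ α / n := by
    calc (B.card : ℝ) ≤ ((Finset.univ.filter fun π : Equiv.Perm (Fin n) =>
          t₀ ≤ |∑ j : Fin n, η (π j) j - (∑ j : Fin n, ∑ i : Fin n, η i j) / n|).card : ℝ) := by
          exact_mod_cast hBsub
      _ ≤ _ := hBound
      _ ≤ α / n := htail
  -- `α v = Σ_{x ∈ X} (m - F x) ≤ α t₀ + m · |B|`
  have hF0 : ∀ x : Equiv.Perm (Fin n), 0 ≤ ∑ j : Fin n, η (x j) j := fun x =>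
    Finset.sum_nonneg fun j _ => hη0 _ _
  have hsplit : α * v ≤ α * t₀ + mη * B.card := by
    have e1 : α * v = ∑ x ∈ X, (mη - ∑ j : Fin n, η (x j) j) := by
      rw [Finset.sum_sub_distrib, Finset.sum_const, nsmul_eq_mul, hkey, ← hα]; ring
    rw [e1, ← Finset.sum_filter_add_sum_filter_not X (fun x => t₀ ≤ mη - ∑ j : Fin n, η (x j) j)]
    have h1 : ∑ x ∈ X.filter (fun x => t₀ ≤ mη - ∑ j : Fin n, η (x j) j),
        (mη - ∑ j : Fin n, η (x j) j) ≤ mη * B.card := by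
      rw [← hB]
      calc ∑ x ∈ B, (mη - ∑ j : Fin n, η (x j) j) ≤ ∑ x ∈ B, mη :=
            Finset.sum_le_sum fun x _ => by linarith [hF0 x]
        _ = mη * B.card := by rw [Finset.sum_const, nsmul_eq_mul, mul_comm]
    have h2 : ∑ x ∈ X.filter (fun x => ¬ (t₀ ≤ mη - ∑ j : Fin n, η (x j) j)),
        (mη - ∑ j : Fin n, η (x j) j) ≤ α * t₀ := by
      calc ∑ x ∈ X.filter (fun x => ¬ (t₀ ≤ mη - ∑ j : Fin n, η (x j) j)),
            (mη - ∑ j : Fin n, η (x j) j)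
          ≤ ∑ x ∈ X.filter (fun x => ¬ (t₀ ≤ mη - ∑ j : Fin n, η (x j) j)), t₀ :=
            Finset.sum_le_sum fun x hx => (not_le.1 (Finset.mem_filter.1 hx).2).le
        _ = t₀ * (X.filter (fun x => ¬ (t₀ ≤ mη - ∑ j : Fin n, η (x j) j))).card := by
            rw [Finset.sum_const, nsmul_eq_mul, mul_comm]
        _ ≤ t₀ * α := by
            rw [hα]
            exact mul_le_mul_of_nonneg_left (by exact_mod_cast Finset.card_filter_le _ _) ht₀0.le
        _ = α * t₀ := mul_comm _ _
    linarith
  -- hence `v ≤ t₀ + 1`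
  have hv1 : v ≤ t₀ + 1 := by
    have h1 : mη * B.card ≤ n * (α / n) :=
      mul_le_mul hmηle hBcard (Nat.cast_nonneg _) hn0.le
    have h2 : (n : ℝ) * (α / n) = α := by field_simp
    rw [h2] at h1
    have h3 : α * v ≤ α * (t₀ + 1) := by linarith
    exact le_of_mul_le_mul_left h3 hα0
  -- AM-GM on `r = √(32θvL)` and the conclusion `v ≤ (32θ + 22) L + 2 ≤ 100 L`
  have hvL : v ≤ 100 * L := by
    have hamgm : r ≤ v / 2 + 16 * θ * L := by
      have hS0 : 0 ≤ v / 2 + 16 * θ * L := by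
        have := mul_nonneg hθ0.le hL0.le; linarith
      have hsq : r ^ 2 ≤ (v / 2 + 16 * θ * L) ^ 2 := by
        nlinarith [hrsq, sq_nonneg (v / 2 - 16 * θ * L)]
      exact (pow_le_pow_iff_left₀ hr0 hS0 two_ne_zero).1 hsq
    have : v ≤ (32 * θ + 22) * L + 2 := by rw [ht₀] at hv1; linarith
    nlinarith [hθle, hL1, this, hθ0]
  -- back to `δ`: `Σ δ² = (α/n)² · n · v = (α²/n) · v`
  have hsumδ : ∑ i : Fin n, ∑ j : Fin n, δ i j ^ 2 = (α ^ 2 / n) * v := by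
    calc ∑ i : Fin n, ∑ j : Fin n, δ i j ^ 2 = ∑ i : Fin n, ∑ j : Fin n, (α / n) ^ 2 * η i j ^ 2 :=
          Finset.sum_congr rfl fun i _ => Finset.sum_congr rfl fun j _ => by rw [hδη i j, mul_pow]
      _ = (α / n) ^ 2 * ∑ i : Fin n, ∑ j : Fin n, η i j ^ 2 := by
          rw [Finset.mul_sum]
          refine Finset.sum_congr rfl fun i _ => ?_
          rw [Finset.mul_sum]
      _ = (α ^ 2 / n) * v := by
          rw [hv, Finset.sum_comm (s := Finset.univ) (t := Finset.univ) (f := fun j i => η i j ^ 2)]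
          field_simp
  calc ∑ i : Fin n, ∑ j : Fin n, (max 0 ((X.card : ℝ) / n - ((X.filter fun x => x j = i).card : ℝ))) ^ 2
      = ∑ i : Fin n, ∑ j : Fin n, δ i j ^ 2 := rfl
    _ = (α ^ 2 / n) * v := hsumδ
    _ ≤ (α ^ 2 / n) * (100 * L) := mul_le_mul_of_nonneg_left hvL (div_nonneg (sq_nonneg α) hn0.le)
    _ = 100 * ((X.card : ℝ) ^ 2 / n) * Real.log (4 * n * n.factorial / X.card) := by
        rw [hL, ← hα]; ring

end Summit.MatrixMultiplication.MatrixMultiplication.Theorems.PolynomialSlack
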